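import Literature.MathematicalPhysics.QuantumFieldTheory.Balaban1983to89.Node00.OpsYDelta2Form

/-!
# `Balaban1983to89.Node00.OpsYSectDReal` — [B9] pp. 390–392: every Sect. A–E operator of def-Y's record acts on Hermitian-matrix-valued functions, i.e.
# COMMUTES WITH HERMITIAN CONJUGATION at a unitary background; the displayed reality binder `hH` of `Node00.OpsYDelta2Form` discharged

T. Bałaban, *Propagators for lattice gauge theories in a background field*, Commun. Math. Phys. **99** (1985) 389–434
[`Balaban1985BackgroundPropagators`, "B9"].

statement-level skeleton of published theorems with citation tags; proofs where landed; nothing here is a claim about the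
Yang–Mills mass gap

THE PRINTED LOCI (text layer pp. 390–392, `lit read paper:balaban1985-cmp99-background-propagators --pages 2-4`; «𝔤-valued» below is the N06 ∕ def-Y
lineage's PARAPHRASE, not a printed phrase).  p. 391: *"In the sequel we will frequently use adjoint operators to derivatives D. The adjoints are taken with
respect to natural L² scalar products for functions with values in N × N hermitian matrices."*; p. 392 (on `Δ^η(U)` of (3.10)): *"For U with values in the
unitary group U(N) it is a hermitian operator given by the quadratic form"* (3.10); p. 390 introduces the covariant derivatives *"For a matrix valued function
A defined at points of the lattice"* (3.3); Thm 3.11 p. 416: *"It is a symmetric and invertible operator"*.  So print's function spaces are spaces of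
HERMITIAN-matrix-valued lattice functions (the Lie algebra `𝔤 = u(N)` after the factor `i`), its scalar products `⟨A, B⟩ = Σ_b η^d tr A(b)B(b)` are REAL
inner products on them, and every operator of Sects. A–E (`D`, `D\*`, `Q`, `Q\*`, `Q′`, `R`, `Δ`, `Δ_a`, `G`, `G′`, `G̃`, `H`, `G₁`, `H₁`, `𝔊`, …) is an
operator ON them.  In def-Y's typing the carriers are `M_N(ℂ)`-valued functions (`CfgY`, `FBondY i → M_N(ℂ)`, …) and the operators are `ℂ`-linear; the
statement «`T` maps Hermitian-valued functions to Hermitian-valued functions» is then EXACTLY «`T` commutes with the conjugate-linear involution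
`Λ ↦ Λ⋆`»: `T(Λ⋆) = (TΛ)⋆` — the predicate `IsRealOpY T` of this file (a `ℂ`-linear `T` with this property preserves the real subspace of
Hermitian-valued functions and is determined by its restriction to it).

WHY THIS FILE (def-Y = OWNER of the `OpsY` instance at the record; located gap: the binder `hH` of FILE 20).  `Node00.OpsYDelta2Form` (gen 9, FILE 20)
typed (3.134)'s `Δ⁽²⁾(U)` as a function of [5]'s form `C⁽²⁾` and DISCHARGED gen 8's displayed symmetry binder `hΔ2` of the N06 certificate modulo
THREE displayed letter properties: reality of `C⁽²⁾(U)`, covariance of `C⁽²⁾` (both [5]'s), and REALITY OF n06-i's `H(U) = G̃Q\*(QG̃Q\*)⁻¹` (3.126)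
at the tables of record — a property of def-Y's own tables (`parSymY`, `parBY`, `GpY parSymY`) and structure maps, print's pp. 391–392 (hermitian-valued functions, hermitian operators), owed by
nobody else.  This file proves it, as the last link of a closure calculus that covers EVERY operator letter of the record: the predicate is closed
under `id ∕ ∘ ∕ + ∕ − ∕ real scalars ∕ Σ` and — the one non-trivial clause — under `Ring.inverse` (§0: if `T` commutes with `⋆` so does its
`Module.End` inverse, and `Ring.inverse` of a non-unit is `0`); the transported lifts `trLiftY ∕ kernelTrOpY` (def-Y, `Node00.OpsYDeltaA ∕
OpsYDeltaPrimeA`) are real at star-unitary transporter tables (§1, pv27's `B9Eq310Hermitian.star_R` BY NAME); hence (§2) def-Y's `D_U`, `D\*_U` (both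
sectors: `gradY ∕ divY ∕ curlY ∕ coCurlY ∕ lapSL`), `Q(U) ∕ Q\*(U) ∕ Q′(U) ∕ Q′\*(U)`, `a`, the Jordan and commutator insertions of the Hessian
(`jordanY`, `curv2Y` — `Re ∕ Im U(∂p)` Hermitian, n06-j's `conjTranspose_reHolY ∕ conjTranspose_weight ∕ conjTranspose_commY` BY NAME), `Δ(U) = hessY`,
`Δ′_a(U)`, `G′ = GpY`, `Q′G′²Q′\*`, its inverse, the projection `R(U)`, `Δ_a(U)`, `G = Δ_a⁻¹`, `C(U)` (3.48); (§3) n06-i's Sect. D letters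
`1 − DG′RD\*`, `1 − DRG′D\*`, `Δ_π`, `G̃⁻¹`, `G̃ = GDY`, `QG̃Q\*`, `(QG̃Q\*)⁻¹`, ★ `H = HDY`, and def-Y's Sect. E constructors `G₁ ∕ H₁ ∕ (QG₁Q\*)⁻¹ ∕ 𝔓 ∕ 𝔊`
over ANY real residual letter `Δ⁽²⁾`; (§4) at the tables of record (`parSymY ∕ parBY` are unitary-valued at unitary `U`: def-Y's `parSymY_mem ∕
parBY_mem`), ★★ `HDY_star_of_unitary` — LITERALLY the binder `hH`; (§5) ★★★ `lettersYOfRecordV4_symmDG₁GG_ofC2_real`: edition 8's `GD ∧ G₁ ∧ GG`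
symmetry at `𝔯 := resYOfC2 𝔠` with ONLY the reality of [5]'s `C⁽²⁾` displayed, and ★★★ `lettersYOfRecordV4_isRealOpY_ofC2`: ALL THIRTEEN operator
letters of `lettersYOfRecordV4 N θ M⋆ (resYOfC2 𝔠) x` (`Gp, GA, C, GD, G₁, GG, Kdiff, H, H₁, QGQinv, QG1Qinv, Ck, P349`) are real at a unitary-valued
background, modulo the reality of `C⁽²⁾(U)` alone.

MODEL ∕ DICTIONARY.  (D1) `IsRealOpY T := ∀ Λ, T (star Λ) = star (T Λ)` for `T : (X → 𝔸) →ₗ[ℂ] (Y → 𝔸)`, `star` pointwise (`Pi.star_apply`); at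
`𝔸 = M_N(ℂ)`, `star = ᴴ` (`Matrix.star_eq_conjTranspose`), so n06-j's `conjTranspose_*` lemmas are consumed verbatim.  (D2) «unitary background»:
`(U_μ(x) : M_N(ℂ)) ∈ unitary` (n06-j's hypothesis shape, `B9Thm311AdjointPairs`), interchangeable with def-Y's `U_μ(x) ∈ B7Prop2Explicit.unitaryUnits`
(`mem_unitaryUnits`, `Iff.rfl`) and implied by `SU(N)`-valuedness (`specialUnitaryUnits_le_unitaryUnits`); transporter TABLES enter through pv27's
orientation `W⁻¹ = W⋆` (`B9Eq310Hermitian.star_R`), supplied by n06-j's `val_inv_eq_conjTranspose`.  (D3) Nothing is redefined: every letter is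
def-Y's (`Node00.OpsYDeltaA ∕ OpsYDeltaPrimeA ∕ OpsYRecordV4 ∕ OpsYSectDE ∕ OpsYDelta2Form`) or n06-i's (`B9Eq3132SectDLetters`) BY NAME, and every
matrix-level fact is n06-j's (`B9Thm311AdjointAtLetters ∕ AdjointPairs ∕ DeltaPrimeSymm ∕ Curv2Symm`) or pv27's (`B9Eq310Hermitian`) BY NAME.

WHAT IS DEFINED ∕ PROVED (0 sorry).
* §0 `IsRealOpY` and its closure calculus `IsRealOpY.apply ∕ star_apply ∕ apply_eq_of_star_eq ∕ id ∕ one ∕ zero ∕ comp ∕ mul ∕ add ∕ sub ∕ neg ∕ smul ∕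
  smul_real ∕ sum` and ★ `IsRealOpY.ringInverse`.
* §1 ★ `trLiftY_isRealOpY`, `liftMatY_isRealOpY`, `kernelTrOpY_isRealOpY` (generic `𝔸`, star-unitary tables).
* §2 (`𝔸 = M_N(ℂ)`, unitary `U`, unitary-valued `parS ∕ parB`, real `G′`): `inv_eq_star_of_mem_unitary`, `inv_mem_unitary_of_mem`, `mul_mem_unitary_of_mem`;
  `gradY ∕ divY ∕ curlY ∕ coCurlY ∕ QY ∕ QsY ∕ QpY ∕ QpsY ∕ aY ∕ lapSL ∕ deltaPrimeAY ∕ GpY ∕ XY ∕ XinvY ∕ RY ∕ jordanY ∕ curv2Y ∕ hessY ∕ deltaAY ∕ GAY ∕ CY`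
  `_isRealOpY` (+ `star_primeEdgeY`, `star_contourSum`, `deltaAY_isRealOpY'`).
* §3 n06-i's `gaugePiY ∕ gaugePiTY ∕ deltaPiY ∕ deltaPiAY ∕ GDY ∕ QGQY ∕ QGQinvY ∕` ★★ `HDY` `_isRealOpY`; def-Y's Sect. E constructors over a real `Δ⁽²⁾`:
  `QGQinvOfY ∕ HOfY ∕ delta2PiY ∕ deltaOneY ∕ G1Y ∕ QG1QinvY ∕ H1Y ∕ frakPY ∕ GGY` `_isRealOpY`.
* §4 at the record's tables: `mem_unitary_of_mem_unitaryUnits`, `parSymY_mem_unitary`, `parBY_mem_unitary`, `GpY_parSymY ∕ GDY_record ∕ QGQinvY_record ∕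
  HDY_record ∕ RY_record ∕ CY_record ∕ GAv4Y ∕ GAsndSY ∕ KdiffSY` `_isRealOpY`, ★★ `HDY_star_of_unitary`.
* §5 ★★ `hH_of_record` (the binder `hH` of `lettersYOfRecordV4_symmDG₁GG_ofC2`, as a theorem), `resYOfC2_Δ2_isSymmTr_real`, ★★★
  `lettersYOfRecordV4_symmDG₁GG_ofC2_real`, `resYOfC2_Δ2_isRealOpY`, ★★★ `lettersYOfRecordV4_isRealOpY_ofC2`.

HONEST SCOPE.  Exact finite-dimensional star-algebra; no inequality, no positivity, no invertibility claimed (`Ring.inverse` is total); the reality of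
[5]'s `C⁽²⁾(U)` stays displayed (a property of [5]'s construction, `B7Eq136SecondOrder`, not of NODE 00's tables); nothing about `U`'s outside the
unitary-valued ones (print's `G ⊂ U(N)`).  NOT a node discharge, NOT summit progress; count-neutral; nothing continuum, nothing about reflection positivity or
the mass gap.  Cell `pub-ymgap` (HUMAN RULING D-0062), Track A NODE 00 definer row def-Y (successor gen 9), 2026-08-27.
-/

noncomputable section

namespace Literature.MathematicalPhysics.QuantumFieldTheory.Balaban1983to89.Node00

open B6KLevelCensusIndexV1 (KIdx)
open B9PinMembersKLevelV1 (MemberY)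
open B7Prop2SpecialUnitary (specialUnitaryUnits specialUnitaryUnits_le_unitaryUnits)
open B9Thm311ReadingCoords (trIP IsSymmTr)
open B9Thm311AdjointAtLetters (val_inv_eq_conjTranspose)
open B9Thm311AdjointPairs (gradT_mem_unitary curlT_mem_unitary holY_mem_unitary conjTranspose_reHolY)
open B9Thm311Curv2Symm (curv2Y_apply primeEdgeY_apply contourSum contourSum_apply conjTranspose_commY conjTranspose_weight edgeParY_mem_unitary
  star_sgnY star_eps)
open B9Eq3132SectDLetters (gaugePiY gaugePiTY deltaPiY deltaPiAY GDY QGQY QGQinvY HDY)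
open scoped Matrix

/-! ## §0 The predicate `IsRealOpY` and its closure calculus -/

section Generic

variable {𝔸 : Type*} [Ring 𝔸] [StarRing 𝔸] [Algebra ℂ 𝔸]
variable {X Y Z : Type}

/-- ★ **`T` acts on Hermitian-valued (the lineage's «`𝔤`-valued») functions**: the `ℂ`-linear operator `T` commutes with Hermitian conjugation,
`T(Λ⋆) = (TΛ)⋆` (p. 391: *"functions with values in N × N hermitian matrices"*). [cite: Balaban1985BackgroundPropagators, p.391 (hermitian-valued functions), p.392 (Δ(U) hermitian), dictionary (D1)] -/
def IsRealOpY (T : (X → 𝔸) →ₗ[ℂ] (Y → 𝔸)) : Prop := ∀ Λ : X → 𝔸, T (star Λ) = star (T Λ)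

namespace IsRealOpY

/-- unfolding. [cite: Balaban1985BackgroundPropagators, p.390, bookkeeping] -/
theorem apply {T : (X → 𝔸) →ₗ[ℂ] (Y → 𝔸)} (h : IsRealOpY T) (Λ : X → 𝔸) : T (star Λ) = star (T Λ) := h Λ

/-- unfolding, read right to left. [cite: Balaban1985BackgroundPropagators, p.390, bookkeeping] -/
theorem star_apply {T : (X → 𝔸) →ₗ[ℂ] (Y → 𝔸)} (h : IsRealOpY T) (Λ : X → 𝔸) : star (T Λ) = T (star Λ) := (h Λ).symm

/-- a real operator maps Hermitian-valued functions to Hermitian-valued functions. [cite: Balaban1985BackgroundPropagators, p.391 (hermitian-valued functions)] -/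
theorem apply_eq_of_star_eq {T : (X → 𝔸) →ₗ[ℂ] (Y → 𝔸)} (h : IsRealOpY T) {Λ : X → 𝔸} (hΛ : star Λ = Λ) : star (T Λ) = T Λ := by
  rw [← h, hΛ]

/-- `1` is real. [cite: Balaban1985BackgroundPropagators, p.390, bookkeeping] -/
protected theorem id : IsRealOpY (LinearMap.id : (X → 𝔸) →ₗ[ℂ] (X → 𝔸)) := fun _ => rfl

/-- `1` (as a `Module.End`) is real. [cite: Balaban1985BackgroundPropagators, p.390, bookkeeping] -/
protected theorem one : IsRealOpY (1 : Module.End ℂ (X → 𝔸)) := fun _ => rfl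

/-- `0` is real. [cite: Balaban1985BackgroundPropagators, p.390, bookkeeping] -/
protected theorem zero : IsRealOpY (0 : (X → 𝔸) →ₗ[ℂ] (Y → 𝔸)) := fun _ => by
  rw [LinearMap.zero_apply, LinearMap.zero_apply, star_zero]

/-- composites of real operators are real. [cite: Balaban1985BackgroundPropagators, p.390, bookkeeping] -/
theorem comp {S : (Y → 𝔸) →ₗ[ℂ] (Z → 𝔸)} {T : (X → 𝔸) →ₗ[ℂ] (Y → 𝔸)} (hS : IsRealOpY S) (hT : IsRealOpY T) : IsRealOpY (S ∘ₗ T) :=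
  fun Λ => by rw [LinearMap.comp_apply, hT, hS, LinearMap.comp_apply]

/-- products (in `Module.End`) of real operators are real. [cite: Balaban1985BackgroundPropagators, p.390, bookkeeping] -/
theorem mul {S T : Module.End ℂ (X → 𝔸)} (hS : IsRealOpY S) (hT : IsRealOpY T) : IsRealOpY (S * T) :=
  fun Λ => by rw [Module.End.mul_apply, hT, hS, Module.End.mul_apply]

/-- sums of real operators are real. [cite: Balaban1985BackgroundPropagators, p.390, bookkeeping] -/
theorem add {S T : (X → 𝔸) →ₗ[ℂ] (Y → 𝔸)} (hS : IsRealOpY S) (hT : IsRealOpY T) : IsRealOpY (S + T) :=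
  fun Λ => by rw [LinearMap.add_apply, hS, hT, LinearMap.add_apply, star_add]

/-- differences of real operators are real. [cite: Balaban1985BackgroundPropagators, p.390, bookkeeping] -/
theorem sub {S T : (X → 𝔸) →ₗ[ℂ] (Y → 𝔸)} (hS : IsRealOpY S) (hT : IsRealOpY T) : IsRealOpY (S - T) :=
  fun Λ => by rw [LinearMap.sub_apply, hS, hT, LinearMap.sub_apply, star_sub]

/-- negatives of real operators are real. [cite: Balaban1985BackgroundPropagators, p.390, bookkeeping] -/
theorem neg {T : (X → 𝔸) →ₗ[ℂ] (Y → 𝔸)} (hT : IsRealOpY T) : IsRealOpY (-T) :=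
  fun Λ => by rw [LinearMap.neg_apply, hT, LinearMap.neg_apply, star_neg]

variable [StarModule ℂ 𝔸] in
/-- REAL scalar multiples of real operators are real (`c̄ = c`). [cite: Balaban1985BackgroundPropagators, p.390, bookkeeping] -/
theorem smul {c : ℂ} (hc : star c = c) {T : (X → 𝔸) →ₗ[ℂ] (Y → 𝔸)} (hT : IsRealOpY T) : IsRealOpY (c • T) :=
  fun Λ => by rw [LinearMap.smul_apply, hT, LinearMap.smul_apply, star_smul, hc]

variable [StarModule ℂ 𝔸] in
/-- real scalar multiples of real operators are real. [cite: Balaban1985BackgroundPropagators, p.390, bookkeeping] -/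
theorem smul_real (r : ℝ) {T : (X → 𝔸) →ₗ[ℂ] (Y → 𝔸)} (hT : IsRealOpY T) : IsRealOpY (((r : ℝ) : ℂ) • T) :=
  hT.smul (by rw [Complex.star_def, Complex.conj_ofReal])

/-- finite sums of real operators are real. [cite: Balaban1985BackgroundPropagators, p.390, bookkeeping] -/
theorem sum {κ : Type*} (s : Finset κ) {T : κ → (X → 𝔸) →ₗ[ℂ] (Y → 𝔸)} (h : ∀ k ∈ s, IsRealOpY (T k)) :
    IsRealOpY (∑ k ∈ s, T k) :=
  Finset.sum_induction _ _ (fun _ _ => add) IsRealOpY.zero h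

/-- ★ **THE INVERSE OF A REAL OPERATOR IS REAL** — for the total `Ring.inverse` of `Module.End ℂ`: if `T` is a unit, `T⁻¹(Λ⋆) = (T⁻¹Λ)⋆` because
`T` applied to both sides gives `Λ⋆`; a non-unit has `Ring.inverse T = 0`.  (Every `G`-letter of the record — `G′`, `(Q′G′²Q′*)⁻¹`, `G = Δ_a⁻¹`, `G̃`,
`(QG̃Q*)⁻¹`, `G₁`, `(QG₁Q*)⁻¹` — is such an inverse.) [cite: Balaban1985BackgroundPropagators, (3.27) p.395, (3.122) p.420, (3.128) p.421 (the inverses), bookkeeping] -/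
theorem ringInverse {T : Module.End ℂ (X → 𝔸)} (hT : IsRealOpY T) : IsRealOpY (Ring.inverse T) := by
  by_cases hu : IsUnit T
  · obtain ⟨u, rfl⟩ := hu
    rw [Ring.inverse_unit]
    intro Λ
    have h1 : (u : Module.End ℂ (X → 𝔸)) (star ((↑u⁻¹ : Module.End ℂ (X → 𝔸)) Λ)) = star Λ := by
      rw [hT, ← Module.End.mul_apply, Units.mul_inv, Module.End.one_apply]
    calc (↑u⁻¹ : Module.End ℂ (X → 𝔸)) (star Λ)
        = (↑u⁻¹ : Module.End ℂ (X → 𝔸)) ((u : Module.End ℂ (X → 𝔸)) (star ((↑u⁻¹ : Module.End ℂ (X → 𝔸)) Λ))) := by rw [h1]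
      _ = star ((↑u⁻¹ : Module.End ℂ (X → 𝔸)) Λ) := by rw [← Module.End.mul_apply, Units.inv_mul, Module.End.one_apply]
  · rw [Ring.inverse_non_unit _ hu]
    exact IsRealOpY.zero

end IsRealOpY

/-! ## §1 The transported lifts are real at star-unitary transporters -/

variable [Fintype X]

/-- ★ **A TRANSPORTED LIFT `(M♯_T Λ)(y) = Σ_x M(y,x)·R(T(y,x))Λ(x)` WITH A REAL KERNEL AND STAR-UNITARY TRANSPORTERS IS REAL** (`(R(W)X)⋆ = R(W)X⋆` for
`W⁻¹ = W⋆`: pv27's `B9Eq310Hermitian.star_R`). [cite: Balaban1985BackgroundPropagators, (3.1) p.390, (3.3)–(3.4) pp.390–391, (3.12)–(3.21) pp.393–394] -/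
theorem trLiftY_isRealOpY {𝔸 : Type} [NormedRing 𝔸] [NormedAlgebra ℂ 𝔸] [CompleteSpace 𝔸] [StarRing 𝔸] [StarModule ℂ 𝔸]
    (M : Matrix Y X ℝ) (T : Y → X → 𝔸ˣ) (hT : ∀ y x, (((T y x)⁻¹ : 𝔸ˣ) : 𝔸) = star ((T y x : 𝔸ˣ) : 𝔸)) : IsRealOpY (trLiftY M T) := by
  intro Λ
  funext y
  rw [Pi.star_apply, trLiftY_apply, trLiftY_apply, star_sum]
  refine Finset.sum_congr rfl fun x _ => ?_
  rw [star_smul, Complex.star_def, Complex.conj_ofReal, B9Eq310Hermitian.star_R (hT y x), Pi.star_apply]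

/-- a flat lift of a real matrix is real. [cite: Balaban1985BackgroundPropagators, p.395 (U = 1), bookkeeping] -/
theorem liftMatY_isRealOpY {𝔸 : Type} [NormedRing 𝔸] [NormedAlgebra ℂ 𝔸] [CompleteSpace 𝔸] [StarRing 𝔸] [StarModule ℂ 𝔸]
    (M : Matrix Y X ℝ) : IsRealOpY (liftMatY 𝔸 M) := by
  intro Λ
  funext y
  rw [Pi.star_apply, liftMatY_apply, liftMatY_apply, star_sum]
  refine Finset.sum_congr rfl fun x _ => ?_
  rw [star_smul, Complex.star_def, Complex.conj_ofReal, Pi.star_apply]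

/-- a transported kernel operator with a real kernel and star-unitary transporters is real. [cite: Balaban1985BackgroundPropagators, (3.24) p.394] -/
theorem kernelTrOpY_isRealOpY {𝔸 : Type} [NormedRing 𝔸] [NormedAlgebra ℂ 𝔸] [CompleteSpace 𝔸] [StarRing 𝔸] [StarModule ℂ 𝔸]
    (K : X → X → ℝ) (T : X → X → 𝔸ˣ) (hT : ∀ z w, (((T z w)⁻¹ : 𝔸ˣ) : 𝔸) = star ((T z w : 𝔸ˣ) : 𝔸)) : IsRealOpY (kernelTrOpY K T) := by
  intro Λ
  funext z
  rw [Pi.star_apply, kernelTrOpY_apply, kernelTrOpY_apply, star_sum]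
  refine Finset.sum_congr rfl fun w _ => ?_
  rw [star_smul, Complex.star_def, Complex.conj_ofReal, B9Eq310Hermitian.star_R (hT z w), Pi.star_apply]

end Generic

/-! ## §2 def-Y's structure maps at a unitary background (`𝔸 = M_N(ℂ)`) -/

section Letters

open scoped Matrix.Norms.L2Operator

variable {d ℓ : ℕ} {hd : 1 ≤ d + 1} {hL : Odd (ℓ + 1) ∧ 1 < ℓ + 1} {b₀ b₁ : ℝ} {N : ℕ}
variable (i : KIdx d ℓ hd hL b₀ b₁) (U : CfgY (Matrix (Fin N) (Fin N) ℂ) i)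
variable (hU : ∀ μ x, ((U μ x : (Matrix (Fin N) (Fin N) ℂ)ˣ) : Matrix (Fin N) (Fin N) ℂ) ∈ unitary (Matrix (Fin N) (Fin N) ℂ))

/-- `V⁻¹ = V⋆` for a unitary unit of `M_N(ℂ)` (n06-j's `val_inv_eq_conjTranspose`, in `star` notation; the same statement is
`Summit.QuantumFields.YangMills.Theorems.Prop7CovariantCoercivity.coe_inv_eq_star` of the Summit tree, not importable into `Literature` — cited, restated).
[cite: Balaban1985BackgroundPropagators, p.390 (G ⊂ U(N)), bookkeeping] -/
theorem inv_eq_star_of_mem_unitary {V : (Matrix (Fin N) (Fin N) ℂ)ˣ} (hV : (V : Matrix (Fin N) (Fin N) ℂ) ∈ unitary (Matrix (Fin N) (Fin N) ℂ)) :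
    ((V⁻¹ : (Matrix (Fin N) (Fin N) ℂ)ˣ) : Matrix (Fin N) (Fin N) ℂ) = star (V : Matrix (Fin N) (Fin N) ℂ) :=
  val_inv_eq_conjTranspose V hV

/-- inverses of unitary units are unitary (the same statement is `Summit.QuantumFields.YangMills.Theorems.Prop7CovariantCoercivity.inv_mem_unitary` of the
Summit tree, not importable into `Literature` — cited, restated). [cite: Balaban1985BackgroundPropagators, p.390 (G ⊂ U(N)), bookkeeping] -/
theorem inv_mem_unitary_of_mem {V : (Matrix (Fin N) (Fin N) ℂ)ˣ} (hV : (V : Matrix (Fin N) (Fin N) ℂ) ∈ unitary (Matrix (Fin N) (Fin N) ℂ)) :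
    ((V⁻¹ : (Matrix (Fin N) (Fin N) ℂ)ˣ) : Matrix (Fin N) (Fin N) ℂ) ∈ unitary (Matrix (Fin N) (Fin N) ℂ) :=
  B7Prop2Explicit.mem_unitaryUnits.mp ((B7Prop2Explicit.unitaryUnits _).inv_mem (B7Prop2Explicit.mem_unitaryUnits.mpr hV))

/-- products of unitary units are unitary. [cite: Balaban1985BackgroundPropagators, p.390 (G ⊂ U(N)), bookkeeping] -/
theorem mul_mem_unitary_of_mem {V W : (Matrix (Fin N) (Fin N) ℂ)ˣ} (hV : (V : Matrix (Fin N) (Fin N) ℂ) ∈ unitary (Matrix (Fin N) (Fin N) ℂ))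
    (hW : (W : Matrix (Fin N) (Fin N) ℂ) ∈ unitary (Matrix (Fin N) (Fin N) ℂ)) :
    ((V * W : (Matrix (Fin N) (Fin N) ℂ)ˣ) : Matrix (Fin N) (Fin N) ℂ) ∈ unitary (Matrix (Fin N) (Fin N) ℂ) :=
  B7Prop2Explicit.mem_unitaryUnits.mp ((B7Prop2Explicit.unitaryUnits _).mul_mem (B7Prop2Explicit.mem_unitaryUnits.mpr hV)
    (B7Prop2Explicit.mem_unitaryUnits.mpr hW))

include hU in
/-- ★ `D_U` (sites → bonds) is real at a unitary background. [cite: Balaban1985BackgroundPropagators, (3.3) p.390] -/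
theorem gradY_isRealOpY : IsRealOpY (gradY i U) :=
  trLiftY_isRealOpY (gradK i) (gradT i U) fun b z => inv_eq_star_of_mem_unitary (gradT_mem_unitary i U hU b z)

include hU in
/-- ★ `D*_U` (bonds → sites) is real at a unitary background. [cite: Balaban1985BackgroundPropagators, (3.8) p.392] -/
theorem divY_isRealOpY : IsRealOpY (divY i U) :=
  trLiftY_isRealOpY (divK i) (fun z b => (gradT i U b z)⁻¹) fun z b =>
    inv_eq_star_of_mem_unitary (inv_mem_unitary_of_mem (gradT_mem_unitary i U hU b z))

include hU in
/-- ★ `D_U` (bonds → plaquettes) is real at a unitary background. [cite: Balaban1985BackgroundPropagators, (3.4) p.391] -/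
theorem curlY_isRealOpY : IsRealOpY (curlY i U) :=
  trLiftY_isRealOpY (curlK i) (curlT i U) fun p b => inv_eq_star_of_mem_unitary (curlT_mem_unitary i U hU p b)

include hU in
/-- ★ `D*_U` (plaquettes → bonds) is real at a unitary background. [cite: Balaban1985BackgroundPropagators, (3.9) p.392] -/
theorem coCurlY_isRealOpY : IsRealOpY (coCurlY i U) :=
  trLiftY_isRealOpY (cocurlK i) (fun b p => (curlT i U p b)⁻¹) fun b p =>
    inv_eq_star_of_mem_unitary (inv_mem_unitary_of_mem (curlT_mem_unitary i U hU p b))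

/-- ★ `Q(U)` is real for unitary-valued bond transporters. [cite: Balaban1985BackgroundPropagators, (3.12)–(3.14) p.393] -/
theorem QY_isRealOpY (parB : BondParY (Matrix (Fin N) (Fin N) ℂ) i)
    (hB : ∀ s s', ((parB U s s' : (Matrix (Fin N) (Fin N) ℂ)ˣ) : Matrix (Fin N) (Fin N) ℂ) ∈ unitary (Matrix (Fin N) (Fin N) ℂ)) :
    IsRealOpY (QY i parB U) :=
  trLiftY_isRealOpY (qK i) (qT i parB U) fun _ _ => inv_eq_star_of_mem_unitary (hB _ _)

/-- ★ `Q*(U)` is real for unitary-valued bond transporters. [cite: Balaban1985BackgroundPropagators, (3.13) p.393] -/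
theorem QsY_isRealOpY (parB : BondParY (Matrix (Fin N) (Fin N) ℂ) i)
    (hB : ∀ s s', ((parB U s s' : (Matrix (Fin N) (Fin N) ℂ)ˣ) : Matrix (Fin N) (Fin N) ℂ) ∈ unitary (Matrix (Fin N) (Fin N) ℂ)) :
    IsRealOpY (QsY i parB U) :=
  trLiftY_isRealOpY (qsK i) (fun b ι => (qT i parB U ι b)⁻¹) fun _ _ => inv_eq_star_of_mem_unitary (inv_mem_unitary_of_mem (hB _ _))

/-- ★ `Q′(U)` is real for unitary-valued site transporters. [cite: Balaban1985BackgroundPropagators, (3.21) p.394] -/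
theorem QpY_isRealOpY (parS : SiteParY (Matrix (Fin N) (Fin N) ℂ) i)
    (hS : ∀ z w, ((parS U z w : (Matrix (Fin N) (Fin N) ℂ)ˣ) : Matrix (Fin N) (Fin N) ℂ) ∈ unitary (Matrix (Fin N) (Fin N) ℂ)) :
    IsRealOpY (QpY i parS U) :=
  trLiftY_isRealOpY (qpK i) (qpT i parS U) fun _ _ => inv_eq_star_of_mem_unitary (hS _ _)

/-- ★ `Q′*(U)` is real for unitary-valued site transporters. [cite: Balaban1985BackgroundPropagators, (3.21) p.394] -/
theorem QpsY_isRealOpY (parS : SiteParY (Matrix (Fin N) (Fin N) ℂ) i)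
    (hS : ∀ z w, ((parS U z w : (Matrix (Fin N) (Fin N) ℂ)ˣ) : Matrix (Fin N) (Fin N) ℂ) ∈ unitary (Matrix (Fin N) (Fin N) ℂ)) :
    IsRealOpY (QpsY i parS U) :=
  trLiftY_isRealOpY (qpsK i) (fun z s => (qpT i parS U s z)⁻¹) fun _ _ => inv_eq_star_of_mem_unitary (inv_mem_unitary_of_mem (hS _ _))

/-- the weight operator `a` is real. [cite: Balaban1985BackgroundPropagators, (3.26) p.395] -/
theorem aY_isRealOpY : IsRealOpY (aY i : (IBondY i → Matrix (Fin N) (Fin N) ℂ) →ₗ[ℂ] (IBondY i → Matrix (Fin N) (Fin N) ℂ)) :=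
  liftMatY_isRealOpY (aK i)

include hU in
/-- ★ the covariant site Laplacian `Σ_μ ∇*_{U,μ}∇_{U,μ}` is real at a unitary background (pv27's `star_covD ∕ star_covDstar` BY NAME).
[cite: Balaban1985BackgroundPropagators, (3.23) p.395] -/
theorem lapSL_isRealOpY : IsRealOpY (lapSL i U) := by
  have hU' : ∀ μ z, (((UboxY i U μ z)⁻¹ : (Matrix (Fin N) (Fin N) ℂ)ˣ) : Matrix (Fin N) (Fin N) ℂ) = star ((UboxY i U μ z : (Matrix (Fin N) (Fin N) ℂ)ˣ) : _) :=
    fun μ z => inv_eq_star_of_mem_unitary (hU μ _)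
  intro Λ
  funext z
  rw [Pi.star_apply, lapSL_apply, lapSL_apply]
  unfold lapS
  rw [star_sum]
  refine Finset.sum_congr rfl fun μ _ => ?_
  have hin : star (cdS i U μ Λ) = cdS i U μ (star Λ) := by
    funext w
    rw [Pi.star_apply]
    exact B9Eq310Hermitian.star_covD (shiftY i) (UboxY i U) hU' μ Λ w
  unfold cdsS
  rw [B9Eq310Hermitian.star_covDstar (shiftY i) (UboxY i U) hU' μ, hin]

include hU in
/-- ★ `Δ′_a(U)` is real at a unitary background with unitary-valued site transporters. [cite: Balaban1985BackgroundPropagators, (3.24) p.394] -/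
theorem deltaPrimeAY_isRealOpY (parS : SiteParY (Matrix (Fin N) (Fin N) ℂ) i)
    (hS : ∀ z w, ((parS U z w : (Matrix (Fin N) (Fin N) ℂ)ˣ) : Matrix (Fin N) (Fin N) ℂ) ∈ unitary (Matrix (Fin N) (Fin N) ℂ)) :
    IsRealOpY (deltaPrimeAY i parS U) :=
  (lapSL_isRealOpY i U hU).add (kernelTrOpY_isRealOpY (avgCoeffY i) (avgTrY i parS U) fun _ _ =>
    inv_eq_star_of_mem_unitary (mul_mem_unitary_of_mem (hS _ _) (hS _ _)))

include hU in
/-- ★★ `G′(U) = Δ′_a(U)⁻¹` is real. [cite: Balaban1985BackgroundPropagators, p.395 (G′), Thm 3.2 p.398] -/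
theorem GpY_isRealOpY (parS : SiteParY (Matrix (Fin N) (Fin N) ℂ) i)
    (hS : ∀ z w, ((parS U z w : (Matrix (Fin N) (Fin N) ℂ)ˣ) : Matrix (Fin N) (Fin N) ℂ) ∈ unitary (Matrix (Fin N) (Fin N) ℂ)) :
    IsRealOpY (GpY i parS U) :=
  (deltaPrimeAY_isRealOpY i U hU parS hS).ringInverse

/-- `(Q′G′²Q′*)(U)` is real. [cite: Balaban1985BackgroundPropagators, (3.25) p.395] -/
theorem XY_isRealOpY (parS : SiteParY (Matrix (Fin N) (Fin N) ℂ) i) (Gp : SiteOpY (Matrix (Fin N) (Fin N) ℂ) i)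
    (hS : ∀ z w, ((parS U z w : (Matrix (Fin N) (Fin N) ℂ)ˣ) : Matrix (Fin N) (Fin N) ℂ) ∈ unitary (Matrix (Fin N) (Fin N) ℂ))
    (hGp : IsRealOpY (Gp U)) : IsRealOpY (XY i parS Gp U) :=
  (QpY_isRealOpY i U parS hS).comp (hGp.comp (hGp.comp (QpsY_isRealOpY i U parS hS)))

/-- `(Q′G′²Q′*)⁻¹(U)` is real. [cite: Balaban1985BackgroundPropagators, (3.25) p.395] -/
theorem XinvY_isRealOpY (parS : SiteParY (Matrix (Fin N) (Fin N) ℂ) i) (Gp : SiteOpY (Matrix (Fin N) (Fin N) ℂ) i)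
    (hS : ∀ z w, ((parS U z w : (Matrix (Fin N) (Fin N) ℂ)ˣ) : Matrix (Fin N) (Fin N) ℂ) ∈ unitary (Matrix (Fin N) (Fin N) ℂ))
    (hGp : IsRealOpY (Gp U)) : IsRealOpY (XinvY i parS Gp U) :=
  (XY_isRealOpY i U parS Gp hS hGp).ringInverse

/-- ★ the projection `R(U) = I − G′Q′*(Q′G′²Q′*)⁻¹Q′G′` is real. [cite: Balaban1985BackgroundPropagators, (3.25) p.395] -/
theorem RY_isRealOpY (parS : SiteParY (Matrix (Fin N) (Fin N) ℂ) i) (Gp : SiteOpY (Matrix (Fin N) (Fin N) ℂ) i)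
    (hS : ∀ z w, ((parS U z w : (Matrix (Fin N) (Fin N) ℂ)ˣ) : Matrix (Fin N) (Fin N) ℂ) ∈ unitary (Matrix (Fin N) (Fin N) ℂ))
    (hGp : IsRealOpY (Gp U)) : IsRealOpY (RY i parS Gp U) :=
  IsRealOpY.id.sub (hGp.comp ((QpsY_isRealOpY i U parS hS).comp ((XinvY_isRealOpY i U parS Gp hS hGp).comp
    ((QpY_isRealOpY i U parS hS).comp hGp))))

include hU in
/-- ★ the Jordan insertion `F ↦ ½(F·Re U(∂p) + Re U(∂p)·F)` is real at a unitary background (`Re U(∂p)` Hermitian: n06-j's `conjTranspose_reHolY`).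
[cite: Balaban1985BackgroundPropagators, (3.7) p.391, (3.10) p.392] -/
theorem jordanY_isRealOpY : IsRealOpY (jordanY i U) := by
  intro F
  funext p
  have hre : star (reHolY i U p) = reHolY i U p := conjTranspose_reHolY i U hU p
  have h2 : star (1 / 2 : ℂ) = 1 / 2 := by rw [Complex.star_def, map_div₀, map_one, map_ofNat]
  rw [Pi.star_apply, jordanY_apply, jordanY_apply, star_smul, h2, star_add, star_mul, star_mul, hre, Pi.star_apply, add_comm]

include hU in
/-- the primed contour variables commute with conjugation: `A′(b_m)⋆ = (A⋆)′(b_m)` (`σ_m` real, `V_m` unitary). [cite: Balaban1985BackgroundPropagators, (3.2) p.390] -/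
theorem star_primeEdgeY (p : PlaqY i) (m : Fin 4) (A : FBondY i → Matrix (Fin N) (Fin N) ℂ) :
    star (primeEdgeY i U p m A) = primeEdgeY i U p m (star A) := by
  rw [primeEdgeY_apply, primeEdgeY_apply, star_smul, star_sgnY,
    B9Eq310Hermitian.star_R (inv_eq_star_of_mem_unitary (edgeParY_mem_unitary i U hU p m)), Pi.star_apply]

include hU in
/-- the signed contour sums commute with conjugation (`ε` real). [cite: Balaban1985BackgroundPropagators, (3.10) p.392] -/
theorem star_contourSum (p : PlaqY i) (m : Fin 4) (A : FBondY i → Matrix (Fin N) (Fin N) ℂ) :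
    star (contourSum i U p m A) = contourSum i U p m (star A) := by
  rw [contourSum_apply, contourSum_apply, star_sum]
  refine Finset.sum_congr rfl fun l _ => ?_
  rw [star_smul, star_eps, star_primeEdgeY i U hU]

include hU in
/-- ★ the commutator part `Δ′₂(U)` of the Hessian is real at a unitary background (`c_f²Im U(∂p)` Hermitian, `(i[X, M])⋆ = i[X⋆, M]`: n06-j's
`conjTranspose_weight ∕ conjTranspose_commY`). [cite: Balaban1985BackgroundPropagators, (3.10) p.392] -/
theorem curv2Y_isRealOpY : IsRealOpY (curv2Y i U) := by
  intro A
  funext b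
  have h2 : star (1 / 2 : ℂ) = 1 / 2 := by rw [Complex.star_def, map_div₀, map_one, map_ofNat]
  have hc : ∀ (p : PlaqY i) (X : Matrix (Fin N) (Fin N) ℂ),
      star (commY ((((i.cf ^ 2 : ℝ)) : ℂ) • imHolY i U p) X) = commY ((((i.cf ^ 2 : ℝ)) : ℂ) • imHolY i U p) (star X) :=
    fun p X => conjTranspose_commY (conjTranspose_weight i U hU p) X
  have hV : ∀ (p : PlaqY i) (m : Fin 4), ((((edgeParY i U p m)⁻¹)⁻¹ : (Matrix (Fin N) (Fin N) ℂ)ˣ) : Matrix (Fin N) (Fin N) ℂ) =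
      star ((((edgeParY i U p m)⁻¹ : (Matrix (Fin N) (Fin N) ℂ)ˣ) : Matrix (Fin N) (Fin N) ℂ)) :=
    fun p m => inv_eq_star_of_mem_unitary (inv_mem_unitary_of_mem (edgeParY_mem_unitary i U hU p m))
  rw [Pi.star_apply, curv2Y_apply, curv2Y_apply, star_smul, h2, star_sum]
  refine congrArg (fun X : Matrix (Fin N) (Fin N) ℂ => (1 / 2 : ℂ) • X) ?_
  refine Finset.sum_congr rfl fun p _ => ?_
  rw [star_sum]
  refine Finset.sum_congr rfl fun m _ => ?_
  by_cases h : edgeY i p m = b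
  · rw [if_pos h, if_pos h, star_smul, star_sgnY, B9Eq310Hermitian.star_R (hV p m), hc, star_contourSum i U hU]
  · rw [if_neg h, if_neg h, star_zero]

include hU in
/-- ★★ **THE HESSIAN `Δ(U)` OF (3.10) IS REAL** at a unitary background. [cite: Balaban1985BackgroundPropagators, (3.10) p.392] -/
theorem hessY_isRealOpY : IsRealOpY (hessY i U) :=
  ((coCurlY_isRealOpY i U hU).comp ((jordanY_isRealOpY i U hU).comp (curlY_isRealOpY i U hU))).add (curv2Y_isRealOpY i U hU)

/-! ## §3 n06-i's Sect. D letters -/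

variable (parS : SiteParY (Matrix (Fin N) (Fin N) ℂ) i) (parB : BondParY (Matrix (Fin N) (Fin N) ℂ) i) (Gp : SiteOpY (Matrix (Fin N) (Fin N) ℂ) i)
variable (hS : ∀ z w, ((parS U z w : (Matrix (Fin N) (Fin N) ℂ)ˣ) : Matrix (Fin N) (Fin N) ℂ) ∈ unitary (Matrix (Fin N) (Fin N) ℂ))
variable (hB : ∀ s s', ((parB U s s' : (Matrix (Fin N) (Fin N) ℂ)ˣ) : Matrix (Fin N) (Fin N) ℂ) ∈ unitary (Matrix (Fin N) (Fin N) ℂ))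
variable (hGp : IsRealOpY (Gp U))

include hU hS hGp in
/-- `1 − D_U G′(U)R(U)D*_U` is real. [cite: Balaban1985BackgroundPropagators, (3.119) p.419] -/
theorem gaugePiY_isRealOpY : IsRealOpY (gaugePiY i parS Gp U) :=
  IsRealOpY.id.sub ((gradY_isRealOpY i U hU).comp (hGp.comp ((RY_isRealOpY i U parS Gp hS hGp).comp (divY_isRealOpY i U hU))))

include hU hS hGp in
/-- `1 − D_U R(U)G′(U)D*_U` is real. [cite: Balaban1985BackgroundPropagators, (3.119) p.419] -/
theorem gaugePiTY_isRealOpY : IsRealOpY (gaugePiTY i parS Gp U) :=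
  IsRealOpY.id.sub ((gradY_isRealOpY i U hU).comp ((RY_isRealOpY i U parS Gp hS hGp).comp (hGp.comp (divY_isRealOpY i U hU))))

include hU hS hGp in
/-- `Δ_π(U)` is real. [cite: Balaban1985BackgroundPropagators, (3.119) p.419] -/
theorem deltaPiY_isRealOpY : IsRealOpY (deltaPiY i parS Gp U) :=
  (gaugePiTY_isRealOpY i U hU parS Gp hS hGp).comp ((hessY_isRealOpY i U hU).comp (gaugePiY_isRealOpY i U hU parS Gp hS hGp))

include hU hS hB hGp in
/-- `G̃⁻¹(U) = Δ_π + DRD* + Q*aQ` is real. [cite: Balaban1985BackgroundPropagators, (3.122) p.420] -/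
theorem deltaPiAY_isRealOpY : IsRealOpY (deltaPiAY i parS parB Gp U) :=
  ((deltaPiY_isRealOpY i U hU parS Gp hS hGp).add ((gradY_isRealOpY i U hU).comp ((RY_isRealOpY i U parS Gp hS hGp).comp
    (divY_isRealOpY i U hU)))).add ((QsY_isRealOpY i U parB hB).comp ((aY_isRealOpY i).comp (QY_isRealOpY i U parB hB)))

include hU hS hB hGp in
/-- ★★ Sect. D's `G̃(U)` is real. [cite: Balaban1985BackgroundPropagators, (3.122) p.420] -/
theorem GDY_isRealOpY : IsRealOpY (GDY i parS parB Gp U) :=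
  (deltaPiAY_isRealOpY i U hU parS parB Gp hS hB hGp).ringInverse

include hU hS hB hGp in
/-- `(QG̃Q*)(U)` is real. [cite: Balaban1985BackgroundPropagators, (3.123) p.420] -/
theorem QGQY_isRealOpY : IsRealOpY (QGQY i parS parB Gp U) :=
  (QY_isRealOpY i U parB hB).comp ((GDY_isRealOpY i U hU parS parB Gp hS hB hGp).comp (QsY_isRealOpY i U parB hB))

include hU hS hB hGp in
/-- ★ `(QG̃Q*)⁻¹(U)` is real. [cite: Balaban1985BackgroundPropagators, (3.123) p.420, (3.132) p.422] -/
theorem QGQinvY_isRealOpY : IsRealOpY (QGQinvY i parS parB Gp U) :=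
  (QGQY_isRealOpY i U hU parS parB Gp hS hB hGp).ringInverse

include hU hS hB hGp in
/-- ★★ **`H(U) = G̃Q*(QG̃Q*)⁻¹` (3.126) IS REAL** at a unitary background with unitary-valued transporters and a real `G′`. [cite: Balaban1985BackgroundPropagators, (3.126) p.420] -/
theorem HDY_isRealOpY : IsRealOpY (HDY i parS parB Gp U) :=
  (GDY_isRealOpY i U hU parS parB Gp hS hB hGp).comp ((QsY_isRealOpY i U parB hB).comp (QGQinvY_isRealOpY i U hU parS parB Gp hS hB hGp))

include hB in
/-- def-Y's `(QGQ*)⁻¹` constructor over any real `G` is real. [cite: Balaban1985BackgroundPropagators, (3.132) p.422] -/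
theorem QGQinvOfY_isRealOpY (G : BondOpY (Matrix (Fin N) (Fin N) ℂ) i) (hG : IsRealOpY (G U)) : IsRealOpY (QGQinvOfY i parB G U) :=
  ((QY_isRealOpY i U parB hB).comp (hG.comp (QsY_isRealOpY i U parB hB))).ringInverse

include hB in
/-- def-Y's `H = GQ*(QGQ*)⁻¹` constructor over any real `G` is real. [cite: Balaban1985BackgroundPropagators, (3.126) p.420, (3.129) p.421] -/
theorem HOfY_isRealOpY (G : BondOpY (Matrix (Fin N) (Fin N) ℂ) i) (hG : IsRealOpY (G U)) : IsRealOpY (HOfY i parB G U) :=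
  hG.comp ((QsY_isRealOpY i U parB hB).comp (QGQinvOfY_isRealOpY i U parB hB G hG))

include hU hS hGp in
/-- `Δ(U) + D_U R(U) D*_U` is real. [cite: Balaban1985BackgroundPropagators, (3.26) p.395] -/
theorem deltaAY_isRealOpY' : IsRealOpY (hessY i U + gradY i U ∘ₗ RY i parS Gp U ∘ₗ divY i U) :=
  (hessY_isRealOpY i U hU).add ((gradY_isRealOpY i U hU).comp ((RY_isRealOpY i U parS Gp hS hGp).comp (divY_isRealOpY i U hU)))

include hU hS hB hGp in
/-- ★ `Δ_a(U) = Δ(U) + DRD* + Q*aQ` (3.26) is real. [cite: Balaban1985BackgroundPropagators, (3.26) p.395] -/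
theorem deltaAY_isRealOpY : IsRealOpY (deltaAY i parS parB Gp U) :=
  (deltaAY_isRealOpY' i U hU parS Gp hS hGp).add ((QsY_isRealOpY i U parB hB).comp ((aY_isRealOpY i).comp (QY_isRealOpY i U parB hB)))

include hU hS hB hGp in
/-- ★★ `G(U) = Δ_a(U)⁻¹` (3.27) is real. [cite: Balaban1985BackgroundPropagators, (3.27) p.395] -/
theorem GAY_isRealOpY : IsRealOpY (GAY i parS parB Gp U) :=
  (deltaAY_isRealOpY i U hU parS parB Gp hS hB hGp).ringInverse

include hS hGp in
/-- `C(U)` (3.48) is real. [cite: Balaban1985BackgroundPropagators, (3.48) p.398] -/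
theorem CY_isRealOpY : IsRealOpY (CY i parS Gp U) :=
  (XinvY_isRealOpY i U parS Gp hS hGp).comp (liftMatY_isRealOpY _)

variable (Δ2 : BondOpY (Matrix (Fin N) (Fin N) ℂ) i) (hΔ2 : IsRealOpY (Δ2 U))

include hU hS hGp hΔ2 in
/-- `Δ⁽²⁾_π(U)` is real for a real residual letter `Δ⁽²⁾(U)`. [cite: Balaban1985BackgroundPropagators, (3.128) p.421, (3.134) p.422] -/
theorem delta2PiY_isRealOpY : IsRealOpY (delta2PiY i parS Gp Δ2 U) :=
  (gaugePiTY_isRealOpY i U hU parS Gp hS hGp).comp (hΔ2.comp (gaugePiY_isRealOpY i U hU parS Gp hS hGp))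

include hU hS hB hGp hΔ2 in
/-- `G₁(U)⁻¹` (3.128) is real for a real `Δ⁽²⁾(U)`. [cite: Balaban1985BackgroundPropagators, (3.128) p.421] -/
theorem deltaOneY_isRealOpY : IsRealOpY (deltaOneY i parS parB Gp Δ2 U) :=
  (deltaPiAY_isRealOpY i U hU parS parB Gp hS hB hGp).sub (delta2PiY_isRealOpY i U hU parS Gp hS hGp Δ2 hΔ2)

include hU hS hB hGp hΔ2 in
/-- ★ `G₁(U)` (3.129) is real for a real `Δ⁽²⁾(U)`. [cite: Balaban1985BackgroundPropagators, (3.128)–(3.129) p.421] -/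
theorem G1Y_isRealOpY : IsRealOpY (G1Y i parS parB Gp Δ2 U) :=
  (deltaOneY_isRealOpY i U hU parS parB Gp hS hB hGp Δ2 hΔ2).ringInverse

include hU hS hB hGp hΔ2 in
/-- `(QG₁Q*)⁻¹(U)` is real for a real `Δ⁽²⁾(U)`. [cite: Balaban1985BackgroundPropagators, (3.132) p.422] -/
theorem QG1QinvY_isRealOpY : IsRealOpY (QG1QinvY i parS parB Gp Δ2 U) :=
  QGQinvOfY_isRealOpY i U parB hB _ (G1Y_isRealOpY i U hU parS parB Gp hS hB hGp Δ2 hΔ2)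

include hU hS hB hGp hΔ2 in
/-- ★ `H₁(U) = G₁Q*(QG₁Q*)⁻¹` is real for a real `Δ⁽²⁾(U)`. [cite: Balaban1985BackgroundPropagators, (3.129) p.421] -/
theorem H1Y_isRealOpY : IsRealOpY (H1Y i parS parB Gp Δ2 U) :=
  HOfY_isRealOpY i U parB hB _ (G1Y_isRealOpY i U hU parS parB Gp hS hB hGp Δ2 hΔ2)

include hU hS hB hGp hΔ2 in
/-- `𝔓 = I − G₁Q*(QG₁Q*)⁻¹Q − G₁DRD*` (3.147) is real for a real `Δ⁽²⁾(U)`. [cite: Balaban1985BackgroundPropagators, (3.147) p.425] -/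
theorem frakPY_isRealOpY : IsRealOpY (frakPY i parS parB Gp Δ2 U) :=
  (IsRealOpY.id.sub ((G1Y_isRealOpY i U hU parS parB Gp hS hB hGp Δ2 hΔ2).comp ((QsY_isRealOpY i U parB hB).comp
    ((QG1QinvY_isRealOpY i U hU parS parB Gp hS hB hGp Δ2 hΔ2).comp (QY_isRealOpY i U parB hB))))).sub
    ((G1Y_isRealOpY i U hU parS parB Gp hS hB hGp Δ2 hΔ2).comp ((gradY_isRealOpY i U hU).comp
      ((RY_isRealOpY i U parS Gp hS hGp).comp (divY_isRealOpY i U hU))))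

include hU hS hB hGp hΔ2 in
/-- ★ `𝔊 = 𝔓G₁` (3.145)∕(3.153) is real for a real `Δ⁽²⁾(U)`. [cite: Balaban1985BackgroundPropagators, (3.145) p.424, (3.153) p.426] -/
theorem GGY_isRealOpY : IsRealOpY (GGY i parS parB Gp Δ2 U) :=
  (frakPY_isRealOpY i U hU parS parB Gp hS hB hGp Δ2 hΔ2).comp (G1Y_isRealOpY i U hU parS parB Gp hS hB hGp Δ2 hΔ2)

end Letters

/-! ## §4 At the tables of record -/

section Record

open scoped Matrix.Norms.L2Operator

variable {d ℓ : ℕ} {hd : 1 ≤ d + 1} {hL : Odd (ℓ + 1) ∧ 1 < ℓ + 1} {b₀ b₁ : ℝ} {N : ℕ}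
variable (i : KIdx d ℓ hd hL b₀ b₁) {U : CfgY (Matrix (Fin N) (Fin N) ℂ) i}

/-- def-Y's `unitaryUnits`-valuedness is n06-j's `unitary`-valuedness. [cite: Balaban1985BackgroundPropagators, p.390 (G ⊂ U(N)), bookkeeping] -/
theorem mem_unitary_of_mem_unitaryUnits (hU : ∀ μ x, U μ x ∈ B7Prop2Explicit.unitaryUnits (Matrix (Fin N) (Fin N) ℂ)) :
    ∀ μ x, ((U μ x : (Matrix (Fin N) (Fin N) ℂ)ˣ) : Matrix (Fin N) (Fin N) ℂ) ∈ unitary (Matrix (Fin N) (Fin N) ℂ) :=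
  fun μ x => B7Prop2Explicit.mem_unitaryUnits.mp (hU μ x)

/-- the symmetrised site transporters of record are unitary-valued at a unitary background (def-Y's `parSymY_mem`). [cite: Balaban1985BackgroundPropagators, (3.19) p.393, (3.40) p.397] -/
theorem parSymY_mem_unitary (hU : ∀ μ x, U μ x ∈ B7Prop2Explicit.unitaryUnits (Matrix (Fin N) (Fin N) ℂ)) (z w : SiteY i) :
    ((parSymY i U z w : (Matrix (Fin N) (Fin N) ℂ)ˣ) : Matrix (Fin N) (Fin N) ℂ) ∈ unitary (Matrix (Fin N) (Fin N) ℂ) :=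
  B7Prop2Explicit.mem_unitaryUnits.mp (parSymY_mem i hU z w)

/-- the taxicab bond transporters of record are unitary-valued at a unitary background (def-Y's `parBY_mem`). [cite: Balaban1985BackgroundPropagators, (3.12) p.393, (3.40) p.397] -/
theorem parBY_mem_unitary (hU : ∀ μ x, U μ x ∈ B7Prop2Explicit.unitaryUnits (Matrix (Fin N) (Fin N) ℂ)) :
    ∀ s s', ((parBY i U s s' : (Matrix (Fin N) (Fin N) ℂ)ˣ) : Matrix (Fin N) (Fin N) ℂ) ∈ unitary (Matrix (Fin N) (Fin N) ℂ) :=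
  fun s s' => B7Prop2Explicit.mem_unitaryUnits.mp (parBY_mem i hU s s')

/-- ★ the record's `G′(U)` is real at a unitary background. [cite: Balaban1985BackgroundPropagators, p.395 (G′)] -/
theorem GpY_parSymY_isRealOpY (hU : ∀ μ x, U μ x ∈ B7Prop2Explicit.unitaryUnits (Matrix (Fin N) (Fin N) ℂ)) :
    IsRealOpY (GpY i (parSymY i) U) :=
  GpY_isRealOpY i U (mem_unitary_of_mem_unitaryUnits i hU) (parSymY i) (parSymY_mem_unitary i hU)

/-- ★ the record's `G̃(U)` is real at a unitary background. [cite: Balaban1985BackgroundPropagators, (3.122) p.420] -/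
theorem GDY_record_isRealOpY (hU : ∀ μ x, U μ x ∈ B7Prop2Explicit.unitaryUnits (Matrix (Fin N) (Fin N) ℂ)) :
    IsRealOpY (GDY i (parSymY i) (parBY i) (GpY i (parSymY i)) U) :=
  GDY_isRealOpY i U (mem_unitary_of_mem_unitaryUnits i hU) (parSymY i) (parBY i) (GpY i (parSymY i)) (parSymY_mem_unitary i hU)
    (parBY_mem_unitary i hU) (GpY_parSymY_isRealOpY i hU)

/-- ★ the record's `(QG̃Q*)⁻¹(U)` is real at a unitary background. [cite: Balaban1985BackgroundPropagators, (3.132) p.422] -/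
theorem QGQinvY_record_isRealOpY (hU : ∀ μ x, U μ x ∈ B7Prop2Explicit.unitaryUnits (Matrix (Fin N) (Fin N) ℂ)) :
    IsRealOpY (QGQinvY i (parSymY i) (parBY i) (GpY i (parSymY i)) U) :=
  QGQinvY_isRealOpY i U (mem_unitary_of_mem_unitaryUnits i hU) (parSymY i) (parBY i) (GpY i (parSymY i)) (parSymY_mem_unitary i hU)
    (parBY_mem_unitary i hU) (GpY_parSymY_isRealOpY i hU)

/-- ★★ the record's `H(U)` is real at a unitary background. [cite: Balaban1985BackgroundPropagators, (3.126) p.420] -/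
theorem HDY_record_isRealOpY (hU : ∀ μ x, U μ x ∈ B7Prop2Explicit.unitaryUnits (Matrix (Fin N) (Fin N) ℂ)) :
    IsRealOpY (HDY i (parSymY i) (parBY i) (GpY i (parSymY i)) U) :=
  HDY_isRealOpY i U (mem_unitary_of_mem_unitaryUnits i hU) (parSymY i) (parBY i) (GpY i (parSymY i)) (parSymY_mem_unitary i hU)
    (parBY_mem_unitary i hU) (GpY_parSymY_isRealOpY i hU)

/-- ★★ **THE DISPLAYED BINDER `hH` OF `Node00.OpsYDelta2Form.resYOfC2_Δ2_isSymmTr`, AS A THEOREM**: `H(U)(X⋆) = (H(U)X)⋆` at the tables of record, for every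
unitary-valued background. [cite: Balaban1985BackgroundPropagators, (3.126) p.420, p.391 (hermitian-valued functions)] -/
theorem HDY_star_of_unitary (hU : ∀ μ x, U μ x ∈ B7Prop2Explicit.unitaryUnits (Matrix (Fin N) (Fin N) ℂ))
    (X : IBondY i → Matrix (Fin N) (Fin N) ℂ) :
    HDY i (parSymY i) (parBY i) (GpY i (parSymY i)) U (star X) = star (HDY i (parSymY i) (parBY i) (GpY i (parSymY i)) U X) :=
  HDY_record_isRealOpY i hU X

/-- the record's `R(U)` is real at a unitary background. [cite: Balaban1985BackgroundPropagators, (3.25) p.395] -/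
theorem RY_record_isRealOpY (hU : ∀ μ x, U μ x ∈ B7Prop2Explicit.unitaryUnits (Matrix (Fin N) (Fin N) ℂ)) :
    IsRealOpY (RY i (parSymY i) (GpY i (parSymY i)) U) :=
  RY_isRealOpY i U (parSymY i) (GpY i (parSymY i)) (parSymY_mem_unitary i hU) (GpY_parSymY_isRealOpY i hU)

/-- the record's `C(U)` is real at a unitary background. [cite: Balaban1985BackgroundPropagators, (3.48) p.398] -/
theorem CY_record_isRealOpY (hU : ∀ μ x, U μ x ∈ B7Prop2Explicit.unitaryUnits (Matrix (Fin N) (Fin N) ℂ)) :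
    IsRealOpY (CY i (parSymY i) (GpY i (parSymY i)) U) :=
  CY_isRealOpY i U (parSymY i) (GpY i (parSymY i)) (parSymY_mem_unitary i hU) (GpY_parSymY_isRealOpY i hU)

/-- ★ the record's `G(U) = Δ_a(U)⁻¹` is real at a unitary background. [cite: Balaban1985BackgroundPropagators, (3.27) p.395] -/
theorem GAv4Y_isRealOpY (hU : ∀ μ x, U μ x ∈ B7Prop2Explicit.unitaryUnits (Matrix (Fin N) (Fin N) ℂ)) :
    IsRealOpY (GAv4Y (Matrix (Fin N) (Fin N) ℂ) i U) :=
  GAY_isRealOpY i U (mem_unitary_of_mem_unitaryUnits i hU) (parSymY i) (parBY i) (GpY i (parSymY i)) (parSymY_mem_unitary i hU)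
    (parBY_mem_unitary i hU) (GpY_parSymY_isRealOpY i hU)

end Record

section RecordMember

open scoped Matrix.Norms.L2Operator

variable {d ℓ : ℕ} {hd : 1 ≤ d + 1} {hL : Odd (ℓ + 1) ∧ 1 < ℓ + 1} {b₀ b₁ : ℝ} {N Mstar : ℕ}
variable (x : MemberY d ℓ hd hL b₀ b₁ Mstar) {U : CfgY (Matrix (Fin N) (Fin N) ℂ) x.toKIdx}

/-- `G(Ω′, U)` of the member's second sequence is real at a unitary background. [cite: Balaban1985BackgroundPropagators, Thm 3.14 pp.426–427] -/
theorem GAsndSY_isRealOpY (hU : ∀ μ z, U μ z ∈ B7Prop2Explicit.unitaryUnits (Matrix (Fin N) (Fin N) ℂ)) :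
    IsRealOpY (GAsndSY (Matrix (Fin N) (Fin N) ℂ) x U) :=
  GAv4Y_isRealOpY x.snd hU

/-- ★ Theorem 3.14's letter `G(Ω, U) − G(Ω′, U)` is real at a unitary background. [cite: Balaban1985BackgroundPropagators, Thm 3.14 (3.154) pp.426–427] -/
theorem KdiffSY_isRealOpY (hU : ∀ μ z, U μ z ∈ B7Prop2Explicit.unitaryUnits (Matrix (Fin N) (Fin N) ℂ)) :
    IsRealOpY (KdiffSY (Matrix (Fin N) (Fin N) ℂ) x U) :=
  (GAv4Y_isRealOpY x.toKIdx hU).sub (GAsndSY_isRealOpY x hU)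

end RecordMember

section RecordSymm

open scoped Matrix.Norms.L2Operator

variable {N : ℕ} (θ : Stage3Params) (Mstar : ℕ) (𝔠 : C2Y N θ Mstar)

/-- ★★ **`hH` VERBATIM**: the second displayed binder of FILE 20's `lettersYOfRecordV4_symmDG₁GG_ofC2` holds at every `SU(N)`-valued background.
[cite: Balaban1985BackgroundPropagators, (3.126) p.420, p.390 (G ⊂ U(N))] -/
theorem hH_of_record :
    ∀ (x : MemberY θ.d₆ θ.ℓ₆ θ.hd' θ.hL' θ.b₀ θ.b₁ Mstar) (U : CfgY (Matrix (Fin N) (Fin N) ℂ) x.toKIdx), (∀ μ z, U μ z ∈ specialUnitaryUnits (Fin N)) →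
      ∀ X : IBondY x.toKIdx → Matrix (Fin N) (Fin N) ℂ,
        HDY x.toKIdx (parSymY x.toKIdx) (parBY x.toKIdx) (GpY x.toKIdx (parSymY x.toKIdx)) U (star X) =
          star (HDY x.toKIdx (parSymY x.toKIdx) (parBY x.toKIdx) (GpY x.toKIdx (parSymY x.toKIdx)) U X) :=
  fun x _ hU X => HDY_star_of_unitary x.toKIdx (fun μ z => specialUnitaryUnits_le_unitaryUnits (hU μ z)) X

/-- ★★ gen 8's `hΔ2` for `𝔯 := resYOfC2 𝔠` at a unitary-valued background, now modulo the reality of [5]'s `C⁽²⁾(U)` ALONE.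
[cite: Balaban1985BackgroundPropagators, (3.134) p.422, Thm 3.11 p.416] -/
theorem resYOfC2_Δ2_isSymmTr_real (x : MemberY θ.d₆ θ.ℓ₆ θ.hd' θ.hL' θ.b₀ θ.b₁ Mstar) {U : CfgY (Matrix (Fin N) (Fin N) ℂ) x.toKIdx}
    (hU : ∀ μ y, U μ y ∈ B7Prop2Explicit.unitaryUnits (Matrix (Fin N) (Fin N) ℂ))
    (hC : ∀ A A' : FBondY x.toKIdx → Matrix (Fin N) (Fin N) ℂ, (𝔠 x).form U (star A) (star A') = star ((𝔠 x).form U A A')) :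
    IsSymmTr (fun _ => (1 : ℝ)) ((resYOfC2 N θ Mstar 𝔠 x).Δ2 U) :=
  resYOfC2_Δ2_isSymmTr θ Mstar 𝔠 x hU hC (HDY_star_of_unitary x.toKIdx hU)

/-- ★★★ **EDITION 8's `hsymD` AT THE v4∕v7 RECORD OVER `𝔯 := resYOfC2 𝔠`, WITH ONLY [5]'s LETTER PROPERTY DISPLAYED**: `GD ∧ G₁ ∧ GG` are symmetric
(`IsSymmTr 1`) at every `SU(N)`-valued background, given only that `C⁽²⁾(U; A⋆, A′⋆) = C⁽²⁾(U; A, A′)⋆` there (FILE 20's `hH` discharged by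
`hH_of_record`).  Consumer recipe: `lettersYOfRecordV4_symmDG₁GG_ofC2_real θ.toStage3Params Mstar 𝔠 hCreal` where `hsymD` was.
[cite: Balaban1985BackgroundPropagators, Thm 3.11 p.416, (3.134) p.422, (3.153) p.426] -/
theorem lettersYOfRecordV4_symmDG₁GG_ofC2_real
    (hC : ∀ (x : MemberY θ.d₆ θ.ℓ₆ θ.hd' θ.hL' θ.b₀ θ.b₁ Mstar) (U : CfgY (Matrix (Fin N) (Fin N) ℂ) x.toKIdx), (∀ μ z, U μ z ∈ specialUnitaryUnits (Fin N)) →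
      ∀ A A' : FBondY x.toKIdx → Matrix (Fin N) (Fin N) ℂ, (𝔠 x).form U (star A) (star A') = star ((𝔠 x).form U A A')) :
    ∀ (x : MemberY θ.d₆ θ.ℓ₆ θ.hd' θ.hL' θ.b₀ θ.b₁ Mstar) (U : CfgY (Matrix (Fin N) (Fin N) ℂ) x.toKIdx), (∀ μ z, U μ z ∈ specialUnitaryUnits (Fin N)) →
      IsSymmTr (fun _ => (1 : ℝ)) ((lettersYOfRecordV4 N θ Mstar (resYOfC2 N θ Mstar 𝔠) x).GD U) ∧
        IsSymmTr (fun _ => (1 : ℝ)) ((lettersYOfRecordV4 N θ Mstar (resYOfC2 N θ Mstar 𝔠) x).G₁ U) ∧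
          IsSymmTr (fun _ => (1 : ℝ)) ((lettersYOfRecordV4 N θ Mstar (resYOfC2 N θ Mstar 𝔠) x).GG U) :=
  lettersYOfRecordV4_symmDG₁GG_ofC2 θ Mstar 𝔠 hC (hH_of_record θ Mstar)

/-- ★ the record's residual letter `Δ⁽²⁾(U)` is real at a unitary-valued background for a real `C⁽²⁾(U)` (FILE 20's `resYOfC2_Δ2_star` with `hH` discharged).
[cite: Balaban1985BackgroundPropagators, (3.134) p.422] -/
theorem resYOfC2_Δ2_isRealOpY (x : MemberY θ.d₆ θ.ℓ₆ θ.hd' θ.hL' θ.b₀ θ.b₁ Mstar) {U : CfgY (Matrix (Fin N) (Fin N) ℂ) x.toKIdx}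
    (hU : ∀ μ y, U μ y ∈ B7Prop2Explicit.unitaryUnits (Matrix (Fin N) (Fin N) ℂ))
    (hC : ∀ A A' : FBondY x.toKIdx → Matrix (Fin N) (Fin N) ℂ, (𝔠 x).form U (star A) (star A') = star ((𝔠 x).form U A A')) :
    IsRealOpY ((resYOfC2 N θ Mstar 𝔠 x).Δ2 U) :=
  fun A => resYOfC2_Δ2_star θ Mstar 𝔠 x hU hC (HDY_star_of_unitary x.toKIdx hU) A

/-- ★★★ **EVERY OPERATOR LETTER OF THE RECORD ACTS ON HERMITIAN-VALUED FUNCTIONS**: at a unitary-valued background and for a real `C⁽²⁾(U)`, all thirteen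
operator fields `G′, G = Δ_a⁻¹, C, G̃, G₁, 𝔊, G(Ω) − G(Ω′), H, H₁, (QG̃Q*)⁻¹, (QG₁Q*)⁻¹, C^{(k)}, P` of `lettersYOfRecordV4 N θ M⋆ (resYOfC2 𝔠) x` commute
with Hermitian conjugation (the last two are `0` in the v4 letters, `covLettersY_v4_P349_Ck`). [cite: Balaban1985BackgroundPropagators, pp.390–393, (3.25)–(3.27) p.395, (3.48) p.398, (3.122)–(3.132) pp.420–422, (3.153) p.426, Thm 3.14 pp.426–427] -/
theorem lettersYOfRecordV4_isRealOpY_ofC2 (x : MemberY θ.d₆ θ.ℓ₆ θ.hd' θ.hL' θ.b₀ θ.b₁ Mstar) {U : CfgY (Matrix (Fin N) (Fin N) ℂ) x.toKIdx}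
    (hU : ∀ μ y, U μ y ∈ B7Prop2Explicit.unitaryUnits (Matrix (Fin N) (Fin N) ℂ))
    (hC : ∀ A A' : FBondY x.toKIdx → Matrix (Fin N) (Fin N) ℂ, (𝔠 x).form U (star A) (star A') = star ((𝔠 x).form U A A')) :
    IsRealOpY ((lettersYOfRecordV4 N θ Mstar (resYOfC2 N θ Mstar 𝔠) x).Gp U) ∧
      IsRealOpY ((lettersYOfRecordV4 N θ Mstar (resYOfC2 N θ Mstar 𝔠) x).GA U) ∧
      IsRealOpY ((lettersYOfRecordV4 N θ Mstar (resYOfC2 N θ Mstar 𝔠) x).C U) ∧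
      IsRealOpY ((lettersYOfRecordV4 N θ Mstar (resYOfC2 N θ Mstar 𝔠) x).GD U) ∧
      IsRealOpY ((lettersYOfRecordV4 N θ Mstar (resYOfC2 N θ Mstar 𝔠) x).G₁ U) ∧
      IsRealOpY ((lettersYOfRecordV4 N θ Mstar (resYOfC2 N θ Mstar 𝔠) x).GG U) ∧
      IsRealOpY ((lettersYOfRecordV4 N θ Mstar (resYOfC2 N θ Mstar 𝔠) x).Kdiff U) ∧
      IsRealOpY ((lettersYOfRecordV4 N θ Mstar (resYOfC2 N θ Mstar 𝔠) x).H U) ∧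
      IsRealOpY ((lettersYOfRecordV4 N θ Mstar (resYOfC2 N θ Mstar 𝔠) x).H₁ U) ∧
      IsRealOpY ((lettersYOfRecordV4 N θ Mstar (resYOfC2 N θ Mstar 𝔠) x).QGQinv U) ∧
      IsRealOpY ((lettersYOfRecordV4 N θ Mstar (resYOfC2 N θ Mstar 𝔠) x).QG1Qinv U) ∧
      IsRealOpY ((lettersYOfRecordV4 N θ Mstar (resYOfC2 N θ Mstar 𝔠) x).Ck U) ∧
      IsRealOpY ((lettersYOfRecordV4 N θ Mstar (resYOfC2 N θ Mstar 𝔠) x).P349 U) := by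
  have hUu := mem_unitary_of_mem_unitaryUnits x.toKIdx hU
  have hS := parSymY_mem_unitary x.toKIdx hU
  have hB := parBY_mem_unitary x.toKIdx hU
  have hGp := GpY_parSymY_isRealOpY x.toKIdx hU
  have hΔ2 := resYOfC2_Δ2_isRealOpY θ Mstar 𝔠 x hU hC
  refine ⟨hGp, GAv4Y_isRealOpY x.toKIdx hU, CY_record_isRealOpY x.toKIdx hU, GDY_record_isRealOpY x.toKIdx hU,
    G1Y_isRealOpY x.toKIdx U hUu _ _ _ hS hB hGp _ hΔ2, GGY_isRealOpY x.toKIdx U hUu _ _ _ hS hB hGp _ hΔ2, KdiffSY_isRealOpY x hU,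
    HDY_record_isRealOpY x.toKIdx hU, H1Y_isRealOpY x.toKIdx U hUu _ _ _ hS hB hGp _ hΔ2, QGQinvY_record_isRealOpY x.toKIdx hU,
    QG1QinvY_isRealOpY x.toKIdx U hUu _ _ _ hS hB hGp _ hΔ2, ?_, ?_⟩
  · exact IsRealOpY.zero
  · exact IsRealOpY.zero

end RecordSymm

end Literature.MathematicalPhysics.QuantumFieldTheory.Balaban1983to89.Node00
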